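import Summits.Ventures.CertifiedManyBodySolver.Downfold.RouterWordScoreRedundantAlternatives

/-!
# Single-alternative typings of the §4.2 router-word score in closed form: the EPH-ONLY control class,
# MONO re-derived, pair identity by construction, two-site prints under «EPH»
# (seat hubbard-downfold-score-2 gen 20; registrations of 2026-08-29T23:1xZ for the cur-1 g53 shelf)

Venture CertifiedManyBodySolver, cell `pub/hubbard-downfold`; namespace
`Summit.Ventures.CertifiedManyBodySolver.Downfold.RouterScore`. Everything here is PROVED (no `sorry`, standard axioms).

Most rows of the validation set carry ONE typed alternative in `expected_router_words`: the conventional e–ph rows «EPH»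
(hydrides, A15, borides, the sp / filled-shell controls M32 Cu · M310 NaAlGe · M418 CrP · M459 SrCu₂As₂ · V8-310 SrCu₂Sb₂),
the d⁵ Mn rows MONO «UND:MULTIORB» (M450, M477–M495, V8-311 EuMn₂As₂), the doped-cuprate calibration rows «1BH+3BE». The
earlier files give closed forms for the Fe-sheet pairs / triples / unions (`score_fepair`, `score_triple`, `score_union`,
p730054 / p730367) and obtain MONO through FEPAIR (`score_mono`, p744404). This file proves the closed form of the §4.2 letter
for ANY single typed alternative directly, once, over an arbitrary head alphabet, and reads off what the day's registrations
asserted in prose: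

* §1 (general) `outcome_single_alt` — against ONE alternative `q :: secs` with `q` non-structural, a print `p :: tl` scores:
  structural `p` ⇒ `ABSTAIN_structure`; `p = q` ⇒ `AGREE` if every token of `secs` is in the print, else `PARTIAL`;
  `p ≠ q` ⇒ `PARTIAL` if `q` rides in `tl`, else `DISAGREE`. Corollary `outcome_singleton` for a one-token word `[q]`
  (no secondaries: led by `q` ⇒ `AGREE` whatever rides).
* §2 (heads) `ephOnly := [[eph]]`: `score_ephOnly`, `ephOnly_agree_iff` («AGREE iff LED by EPH»), `ephOnly_partial_iff`
  («EPH rides behind a non-structural head»), `ephOnly_disagree_iff` («no EPH anywhere»); MONO re-derived from §1 and shown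
  to coincide with p744404's `score_mono` (`score_mono_eq_singleton`) — two independent routes to the same table.
* §3 PAIR IDENTITY BY CONSTRUCTION (the sentence «the PAIR is WORD-IDENTICAL under the shared typing iff both print the head»):
  under a shared one-token typing two prints are both `AGREE` iff both are led by the typed head (`singleton_pair_agree_iff`),
  and two prints with the same three-bit signature (structural-led?, led by `q`?, `q` riding?) score identically
  (`singleton_eq_of_signature`).
* §4 TWO-SITE prints under «EPH» (V8-310 SrCu₂Sb₂ has two Cu nets; the first printed site governs, `…TypingsTriple` §5):
  `AGREE` iff the FIRST group is led by «EPH» (`two_site_ephOnly_agree_iff`); a d-head first group with «EPH» anywhere behind it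
  (own group or the second site's) reads `PARTIAL`, and `DISAGREE` needs «EPH» absent from BOTH groups (`two_site_ephOnly_dhead_first`).
* §5 the instances the 23:1xZ registrations quoted, by `decide`: the SrCu₂Sb₂ / M459 «EPH» table, the EuMn₂As₂ MONO table with
  the Eu-4f comparator shapes, and the doped-cuprate «1BH+3BE» single compound alternative read through §1.

WHAT THIS IS NOT: not physics and not a statement about any material; not a typing ruling (the curators and the lead type the
rows); not the scorer of record (`deputy-2/score.py::router_score`, mirrored by `router_score.py::outcome`) — the kernel form of
its §4.2 letter on single-alternative typings, against which both python engines are cross-tested.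
-/

namespace Summit.Ventures.CertifiedManyBodySolver.Downfold

namespace RouterScore

/-! ## §1 One typed alternative, closed form (any head alphabet) -/

section general

variable {α : Type*} [DecidableEq α] (structural : α → Bool)

omit [DecidableEq α] in
/-- a single alternative led by a non-structural head expects no structural primary. [folklore] -/
theorem expectsStructural_single {q : α} (secs : List α) (hq : structural q = false) :
    expectsStructural structural [q :: secs] = false := by
  simp [expectsStructural, hq]

/-- `fullMatch` against a word led by `q` fails on a print led by `p ≠ q`. [folklore] -/
theorem fullMatch_cons_eq_false_of_ne {p q : α} {tl secs : List α} (h : p ≠ q) :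
    fullMatch (p :: tl) (q :: secs) = false := by
  cases hm : fullMatch (p :: tl) (q :: secs) with
  | false => rfl
  | true =>
    simp only [fullMatch, List.head?_cons, Option.some.injEq, Bool.and_eq_true, decide_eq_true_eq] at hm
    exact absurd hm.1.symm h

/-- `fullMatch` fails as soon as one token of the word is missing from the print. [folklore] -/
theorem fullMatch_eq_false_of_missing {e a : List α} {t : α} (ht : t ∈ a) (hte : t ∉ e) :
    fullMatch e a = false := by
  cases h : fullMatch e a with
  | false => rfl
  | true =>
    simp only [fullMatch, covers, Bool.and_eq_true, decide_eq_true_eq, List.all_eq_true] at h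
    exact absurd (h.2 t ht) hte

/-- `primaryEmitted` against a word led by `q` reads «`q` occurs in the print». [folklore] -/
theorem primaryEmitted_cons' (e : List α) (q : α) (secs : List α) :
    primaryEmitted e (q :: secs) = decide (q ∈ e) := rfl

/-- ONE TYPED ALTERNATIVE IN CLOSED FORM. Against `[q :: secs]` with `q` non-structural, the print `p :: tl` scores:
structural `p` ⇒ `ABSTAIN_structure`; led by `q` ⇒ `AGREE` if every secondary of the word is printed, else `PARTIAL`;
led by another head ⇒ `PARTIAL` if `q` rides, else `DISAGREE`. [folklore] -/
theorem outcome_single_alt (p q : α) (tl secs : List α) (hq : structural q = false) :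
    outcome structural (p :: tl) [q :: secs] =
      (if structural p then .ABSTAIN_structure
       else if p = q then (if covers (p :: tl) secs then .AGREE else .PARTIAL)
       else if q ∈ tl then .PARTIAL else .DISAGREE) := by
  have hexp := expectsStructural_single structural secs hq
  by_cases hs : structural p = true
  · rw [if_pos hs]
    exact outcome_structural_abstain structural (by simp) hs hexp
  rw [if_neg hs]
  have hs' : structural p = false := by simpa using hs
  have hgate : (structural p && !expectsStructural structural [q :: secs]) = false := by rw [hs']; rfl
  by_cases hp : p = q
  · rw [if_pos hp]; subst hp
    by_cases hc : covers (p :: tl) secs = true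
    · rw [if_pos hc]
      have hsub : ∀ t ∈ secs, t ∈ p :: tl := by
        simpa [covers, List.all_eq_true] using hc
      have := outcome_eq_agree_of_self_typed structural ([] : List (List α)) hs' hsub
      simpa using this
    · rw [if_neg hc]
      have hmiss : ∃ t ∈ secs, t ∉ p :: tl := by
        simpa [covers, List.all_eq_true] using hc
      obtain ⟨t, ht, hte⟩ := hmiss
      refine outcome_eq_partial_of structural (by simp) hgate ?_ ⟨p :: secs, List.mem_singleton_self _, ?_⟩
      · intro a ha
        rw [List.mem_singleton.1 ha]
        exact fullMatch_eq_false_of_missing (List.mem_cons_of_mem _ ht) hte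
      · rw [primaryEmitted_cons']; simp
  rw [if_neg hp]
  by_cases hm : q ∈ tl
  · rw [if_pos hm]
    refine outcome_eq_partial_of structural (by simp) hgate ?_ ⟨q :: secs, List.mem_singleton_self _, ?_⟩
    · intro a ha
      rw [List.mem_singleton.1 ha]
      exact fullMatch_cons_eq_false_of_ne hp
    · rw [primaryEmitted_cons']; simp [hm]
  · rw [if_neg hm]
    refine outcome_eq_disagree_of_no_primary_emitted structural (by simp) hgate ?_
    intro a ha
    rw [List.mem_singleton.1 ha, primaryEmitted_cons']
    have hne : q ≠ p := fun h => hp h.symm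
    simp [hm, hne]

/-- ONE-TOKEN TYPING `[[q]]` (no secondaries): structural head abstains; led by `q` ⇒ `AGREE` whatever rides; `q` riding ⇒
`PARTIAL`; `q` absent ⇒ `DISAGREE`. [folklore] -/
theorem outcome_singleton (p q : α) (tl : List α) (hq : structural q = false) :
    outcome structural (p :: tl) [[q]] =
      (if structural p then .ABSTAIN_structure
       else if p = q then .AGREE
       else if q ∈ tl then .PARTIAL else .DISAGREE) := by
  rw [outcome_single_alt structural p q tl [] hq]
  by_cases hs : structural p = true
  · rw [if_pos hs, if_pos hs]
  rw [if_neg hs, if_neg hs]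
  by_cases hp : p = q
  · rw [if_pos hp, if_pos hp, if_pos (by simp [covers])]
  · rw [if_neg hp, if_neg hp]

/-- under a one-token typing: `AGREE` iff the print is LED by the typed head. [folklore] -/
theorem singleton_agree_iff (p q : α) (tl : List α) (hq : structural q = false) :
    outcome structural (p :: tl) [[q]] = .AGREE ↔ p = q := by
  rw [outcome_singleton structural p q tl hq]
  by_cases hs : structural p = true
  · rw [if_pos hs]; constructor
    · intro h; exact absurd h (by decide)
    · rintro rfl; rw [hq] at hs; exact absurd hs (by decide)
  rw [if_neg hs]
  by_cases hp : p = q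
  · rw [if_pos hp]; exact ⟨fun _ => hp, fun _ => rfl⟩
  rw [if_neg hp]
  by_cases hm : q ∈ tl
  · rw [if_pos hm]; exact ⟨fun h => absurd h (by decide), fun h => absurd h hp⟩
  · rw [if_neg hm]; exact ⟨fun h => absurd h (by decide), fun h => absurd h hp⟩

/-- under a one-token typing: `PARTIAL` iff the typed head RIDES behind another, non-structural head. [folklore] -/
theorem singleton_partial_iff (p q : α) (tl : List α) (hq : structural q = false) :
    outcome structural (p :: tl) [[q]] = .PARTIAL ↔ structural p = false ∧ p ≠ q ∧ q ∈ tl := by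
  rw [outcome_singleton structural p q tl hq]
  by_cases hs : structural p = true
  · rw [if_pos hs]; simp [hs]
  rw [if_neg hs]
  have hs' : structural p = false := by simpa using hs
  by_cases hp : p = q
  · rw [if_pos hp]; simp [hp]
  rw [if_neg hp]
  by_cases hm : q ∈ tl
  · rw [if_pos hm]; simp [hs', hp, hm]
  · rw [if_neg hm]; simp [hm]

/-- under a one-token typing: `DISAGREE` iff the head is non-structural and the typed head occurs NOWHERE in the print.
[folklore] -/
theorem singleton_disagree_iff (p q : α) (tl : List α) (hq : structural q = false) :
    outcome structural (p :: tl) [[q]] = .DISAGREE ↔ structural p = false ∧ q ∉ p :: tl := by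
  rw [outcome_singleton structural p q tl hq, List.mem_cons, not_or]
  by_cases hs : structural p = true
  · rw [if_pos hs]; simp [hs]
  rw [if_neg hs]
  have hs' : structural p = false := by simpa using hs
  by_cases hp : p = q
  · rw [if_pos hp]; simp [hp]
  rw [if_neg hp]
  have hne : ¬ q = p := fun h => hp h.symm
  by_cases hm : q ∈ tl
  · rw [if_pos hm]; simp [hm]
  · rw [if_neg hm]; simp [hs', hne, hm]

/-- PAIR IDENTITY BY CONSTRUCTION, agreement form: under a SHARED one-token typing two prints are both `AGREE` iff both are
led by the typed head («the PAIR is WORD-IDENTICAL under the shared typing iff both print the head»). [folklore] -/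
theorem singleton_pair_agree_iff (p₁ p₂ q : α) (tl₁ tl₂ : List α) (hq : structural q = false) :
    (outcome structural (p₁ :: tl₁) [[q]] = .AGREE ∧ outcome structural (p₂ :: tl₂) [[q]] = .AGREE) ↔
      (p₁ = q ∧ p₂ = q) := by
  rw [singleton_agree_iff structural p₁ q tl₁ hq, singleton_agree_iff structural p₂ q tl₂ hq]

/-- PAIR IDENTITY BY CONSTRUCTION, signature form: under a shared one-token typing the verdict of a print is a function of
three bits — «structural-led?», «led by `q`?», «`q` rides?» — so two prints with the same bits score identically, whatever
else they carry (riders, parameters, site tags). [folklore] -/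
theorem singleton_eq_of_signature (p₁ p₂ q : α) (tl₁ tl₂ : List α) (hq : structural q = false)
    (hstr : structural p₁ = structural p₂) (hlead : p₁ = q ↔ p₂ = q) (hride : q ∈ tl₁ ↔ q ∈ tl₂) :
    outcome structural (p₁ :: tl₁) [[q]] = outcome structural (p₂ :: tl₂) [[q]] := by
  rw [outcome_singleton structural p₁ q tl₁ hq, outcome_singleton structural p₂ q tl₂ hq, hstr]
  by_cases hs : structural p₂ = true
  · rw [if_pos hs, if_pos hs]
  rw [if_neg hs, if_neg hs]
  by_cases h1 : p₁ = q
  · rw [if_pos h1, if_pos (hlead.1 h1)]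
  rw [if_neg h1, if_neg (fun h2 => h1 (hlead.2 h2))]
  by_cases hm : q ∈ tl₁
  · rw [if_pos hm, if_pos (hride.1 hm)]
  · rw [if_neg hm, if_neg (fun h2 => hm (hride.2 h2))]

end general

open Head

/-! ## §2 On the router's heads: the EPH-ONLY class and MONO re-derived -/

/-- EPH-ONLY «EPH» (the conventional rows; the filled-shell / sp controls M32 Cu, M310 NaAlGe, M418 CrP, M459 SrCu₂As₂,
V8-310 SrCu₂Sb₂). [folklore] -/
def ephOnly : List (List Head) := [[eph]]

/-- EPH-ONLY IN CLOSED FORM: structural head ⇒ abstain; led by «EPH» ⇒ `AGREE` (whatever rides: «+SA», a «UND:STRUCT» rider,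
a d-head riding); «EPH» riding behind another head ⇒ `PARTIAL`; no «EPH» ⇒ `DISAGREE`. [folklore] -/
theorem score_ephOnly (p : Head) (tl : List Head) :
    score (p :: tl) ephOnly =
      (if p.structural then .ABSTAIN_structure
       else if p = eph then .AGREE
       else if eph ∈ tl then .PARTIAL else .DISAGREE) :=
  outcome_singleton Head.structural p eph tl rfl

/-- EPH-ONLY: `AGREE` iff the print is LED by «EPH». [folklore] -/
theorem ephOnly_agree_iff (p : Head) (tl : List Head) : score (p :: tl) ephOnly = .AGREE ↔ p = eph :=
  singleton_agree_iff Head.structural p eph tl rfl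

/-- EPH-ONLY: `PARTIAL` iff «EPH» rides behind another, non-structural head (a d-head or comparator head LEADING with
EPH riding — the pre-named «reader artefact» shape of the filled-shell controls). [folklore] -/
theorem ephOnly_partial_iff (p : Head) (tl : List Head) :
    score (p :: tl) ephOnly = .PARTIAL ↔ p.structural = false ∧ p ≠ eph ∧ eph ∈ tl :=
  singleton_partial_iff Head.structural p eph tl rfl

/-- EPH-ONLY: `DISAGREE` iff the head is non-structural and «EPH» occurs nowhere (a bare d-head, «BI», «CI», a lone
«UND:HF(…)» …). [folklore] -/
theorem ephOnly_disagree_iff (p : Head) (tl : List Head) :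
    score (p :: tl) ephOnly = .DISAGREE ↔ p.structural = false ∧ eph ∉ p :: tl :=
  singleton_disagree_iff Head.structural p eph tl rfl

/-- MONO RE-DERIVED: §1's direct closed form for `[[undMultiorb]]` — the same table as p744404's `score_mono`, which was
obtained through FEPAIR and the redundancy of dominated alternatives; two independent routes, one table. [folklore] -/
theorem score_mono_direct (p : Head) (tl : List Head) :
    score (p :: tl) mono =
      (if p.structural then .ABSTAIN_structure
       else if p = undMultiorb then .AGREE
       else if undMultiorb ∈ tl then .PARTIAL else .DISAGREE) :=
  outcome_singleton Head.structural p undMultiorb tl rfl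

/-- the two routes agree (definitionally the same score; stated for the record). [folklore] -/
theorem score_mono_two_routes (p : Head) (tl : List Head) :
    score (p :: tl) mono = outcome Head.structural (p :: tl) [[undMultiorb]] := rfl

/-! ## §3 Pair identity on the router's heads (the «natural PAIR» sentences of the registrations) -/

/-- Under a shared EPH-ONLY typing (M459 SrCu₂As₂ / V8-310 SrCu₂Sb₂; the Si-B pair; the AAlSi trio) the pair is AGREE ×2 iff
neither prints a d-head in front: both led by «EPH». [folklore] -/
theorem ephOnly_pair_agree_iff (p₁ p₂ : Head) (tl₁ tl₂ : List Head) :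
    (score (p₁ :: tl₁) ephOnly = .AGREE ∧ score (p₂ :: tl₂) ephOnly = .AGREE) ↔ (p₁ = eph ∧ p₂ = eph) :=
  singleton_pair_agree_iff Head.structural p₁ p₂ eph tl₁ tl₂ rfl

/-- Under a shared MONO typing (the trigonal triangle M492 / M493 / M495; EuMn₂As₂ vs M483) the pair is AGREE ×2 iff both print
the k-head in front. [folklore] -/
theorem mono_pair_agree_iff (p₁ p₂ : Head) (tl₁ tl₂ : List Head) :
    (score (p₁ :: tl₁) mono = .AGREE ∧ score (p₂ :: tl₂) mono = .AGREE) ↔ (p₁ = undMultiorb ∧ p₂ = undMultiorb) :=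
  singleton_pair_agree_iff Head.structural p₁ p₂ undMultiorb tl₁ tl₂ rfl

/-- Riders are immaterial to the pair: two k-led prints with DIFFERENT riders (an Eu-4f comparator rider on one, a structure
rider or nothing on the other) score identically under MONO — both `AGREE`. [folklore] -/
theorem mono_riders_immaterial (r₁ r₂ : List Head) :
    score (undMultiorb :: r₁) mono = score (undMultiorb :: r₂) mono := by
  have h := (mono_pair_agree_iff undMultiorb undMultiorb r₁ r₂).2 ⟨rfl, rfl⟩
  rw [h.1, h.2]

/-! ## §4 Two-site prints under «EPH» (V8-310 SrCu₂Sb₂: two Cu nets Cu1 / Cu2; the first printed site governs) -/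

/-- Under EPH-ONLY a two-site print «W₁@site₁; W₂@site₂» (head terms: `(p :: g₁) ++ g₂`) is `AGREE` iff its FIRST group is
led by «EPH» — whatever the second site prints. [folklore] -/
theorem two_site_ephOnly_agree_iff (p : Head) (g₁ g₂ : List Head) :
    score ((p :: g₁) ++ g₂) ephOnly = .AGREE ↔ p = eph := by
  rw [List.cons_append]; exact ephOnly_agree_iff p (g₁ ++ g₂)

/-- «EPH@Cu1; EPH@Cu2» ⇒ `AGREE`; the expected print of the filled-shell two-net control. [folklore] -/
theorem two_site_ephOnly_both_eph (g₁ g₂ : List Head) : score ((eph :: g₁) ++ (eph :: g₂)) ephOnly = .AGREE :=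
  (two_site_ephOnly_agree_iff _ _ _).2 rfl

/-- A d-head FIRST with «EPH» anywhere behind it — in its own group OR only in the second site's group — reads `PARTIAL`
(concatenation puts the second site's «EPH» among the riders); `DISAGREE` needs «EPH» absent from BOTH groups. So for a
two-site row the one-site sentence «a d-head without EPH ⇒ DISAGREE» sharpens to «… without EPH on either site». [folklore] -/
theorem two_site_ephOnly_dhead_first (g₁ g₂ : List Head) :
    score ((undMultiorb :: g₁) ++ (eph :: g₂)) ephOnly = .PARTIAL ∧
    (eph ∉ g₁ → eph ∉ g₂ → score ((undMultiorb :: g₁) ++ g₂) ephOnly = .DISAGREE) := by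
  refine ⟨?_, fun h1 h2 => ?_⟩
  · rw [List.cons_append]
    exact (ephOnly_partial_iff _ _).2 ⟨rfl, by decide, List.mem_append_right _ List.mem_cons_self⟩
  · rw [List.cons_append]
    refine (ephOnly_disagree_iff _ _).2 ⟨rfl, ?_⟩
    simp only [List.mem_cons, List.mem_append, not_or]
    exact ⟨by decide, h1, h2⟩

/-! ## §5 The instances the registrations quoted (PREREG §E 2026-08-29T23:1xZ, block24) -/

/-- V8-310 SrCu₂Sb₂ / M459 SrCu₂As₂ «EPH» table: «EPH», «EPH+SA», «EPH+UND:STRUCT rider», «EPH» with a k-head riding ⇒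
AGREE; k-head or straddle LEADING with EPH riding, any d-led composite ⇒ PARTIAL; k-head alone, «BI», «CI», «UND:HF» alone ⇒
DISAGREE; «UND:STRUCT…»-led ⇒ ABSTAIN(structure); nothing ⇒ ABSTAIN(no word). [folklore] -/
theorem srcu2sb2_table :
    score [eph] ephOnly = .AGREE ∧ score [eph, sa] ephOnly = .AGREE ∧ score [eph, undStruct] ephOnly = .AGREE ∧
    score [eph, undMultiorb] ephOnly = .AGREE ∧
    score [undMultiorb, eph] ephOnly = .PARTIAL ∧ score [undMixed, eph] ephOnly = .PARTIAL ∧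
    score [undMixed, undMultiorb, eph] ephOnly = .PARTIAL ∧
    score [undMultiorb] ephOnly = .DISAGREE ∧ score [bi] ephOnly = .DISAGREE ∧ score [ci] ephOnly = .DISAGREE ∧
    score [undHF] ephOnly = .DISAGREE ∧
    score [undStruct, eph] ephOnly = .ABSTAIN_structure ∧ score [] ephOnly = .ABSTAIN_noWord := by
  decide

/-- V8-311 EuMn₂As₂ MONO table with the Eu-4f comparator shapes transposed from M460: k-head ± riders (EPH, a structure
rider, an f-comparator rider «UND:HF») ⇒ AGREE; MIXED(m)-led composite, «BI» with the k-head riding, «UND:HF»-LED with the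
k-head riding ⇒ PARTIAL; straddle-only, bare «EPH», «BI» alone, «UND:HF» alone ⇒ DISAGREE; setting-led ⇒ ABSTAIN. [folklore] -/
theorem eumn2as2_table :
    score [undMultiorb, eph] mono = .AGREE ∧ score [undMultiorb] mono = .AGREE ∧
    score [undMultiorb, eph, undStruct] mono = .AGREE ∧ score [undMultiorb, undHF, eph] mono = .AGREE ∧
    score [undMultiorb, undMixed, eph] mono = .AGREE ∧
    score [undMixed, undMultiorb, eph] mono = .PARTIAL ∧ score [bi, undMultiorb] mono = .PARTIAL ∧
    score [undHF, undMultiorb, eph] mono = .PARTIAL ∧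
    score [undMixed, eph] mono = .DISAGREE ∧ score [eph] mono = .DISAGREE ∧ score [bi] mono = .DISAGREE ∧
    score [undHF] mono = .DISAGREE ∧
    score [undStruct, undMultiorb, eph] mono = .ABSTAIN_structure := by
  decide

/-- The doped-cuprate calibration typing «1BH+3BE» is ONE compound alternative; §1 reads it: led by «1BH» with «3BE» printed
⇒ AGREE (a «CI» rider immaterial); led by «1BH» WITHOUT «3BE» ⇒ PARTIAL (secondary missing); «3BE»-led or «UND:MIXED»-led with
«1BH» riding ⇒ PARTIAL; «EPH» ⇒ DISAGREE — the §5 cases of `RouterWordScore.lean`, now instances of one closed form. [folklore] -/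
theorem cuprate_single_alt_table :
    score [bh1, be3] [[bh1, be3]] = .AGREE ∧ score [bh1, be3, ci] [[bh1, be3]] = .AGREE ∧
    score [bh1] [[bh1, be3]] = .PARTIAL ∧ score [be3, bh1] [[bh1, be3]] = .PARTIAL ∧
    score [undMixed, bh1, be3] [[bh1, be3]] = .PARTIAL ∧ score [eph] [[bh1, be3]] = .DISAGREE := by
  decide

/-- … and the general sentence behind the second and third rows: under «1BH+3BE», a «1BH»-led print is `AGREE` iff «3BE» is
printed (from `outcome_single_alt`). [folklore] -/
theorem cuprate_bh1_led_agree_iff (tl : List Head) :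
    score (bh1 :: tl) [[bh1, be3]] = .AGREE ↔ be3 ∈ bh1 :: tl := by
  rw [show score (bh1 :: tl) [[bh1, be3]] = outcome Head.structural (bh1 :: tl) [bh1 :: [be3]] from rfl,
    outcome_single_alt Head.structural bh1 bh1 tl [be3] rfl, if_neg (by decide), if_pos rfl]
  by_cases hc : covers (bh1 :: tl) [be3] = true
  · rw [if_pos hc]; simp only [covers, List.all_cons, List.all_nil, Bool.and_true, decide_eq_true_eq] at hc
    exact ⟨fun _ => hc, fun _ => rfl⟩
  · rw [if_neg hc]; simp only [covers, List.all_cons, List.all_nil, Bool.and_true, decide_eq_true_eq] at hc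
    exact ⟨fun h => absurd h (by decide), fun h => absurd h hc⟩

end RouterScore

end Summit.Ventures.CertifiedManyBodySolver.Downfold
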